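import Literature.Computability.Cryptography.QuantumTuringMachineHeadCentredGates
import Literature.Computability.Cryptography.QuantumTuringMachineCodedGates
import Literature.Computability.Cryptography.ClassBQP
import Literature.Computability.Cryptography.CliffordTPolyTimeEntries
import Literature.Computability.QuantumComplexity.CliffordTInverse
import HarnessLib

/-!
# The simulating circuit family of a quantum Turing machine: gate set, layout and circuits (Nishimura–Ozawa 2002, Thm. 4.3, head-centred)

Fourth file of the head-centred simulation (`QuantumTuringMachineHeadCentred.lean`,
`…HeadCentredEntries.lean`, `…HeadCentredGates.lean`, with the coding infrastructure of
`QuantumTuringMachineCodedGates.lean`). Given a machine `M : QTM` (tree model Q8) and a polynomial `p`,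
it DEFINES, in the tree's circuit model (`QGateSet`, `QGate`, `QCircuit`, `QCircuitFamily` of
`Cryptography/QubitRegister.lean`, `QuantumCircuit.lean`):

* the finite gate set `𝒢_M = hcGateSet M` — Clifford+`T` plus the machine-specific gates `W` (local step,
  Nishimura–Ozawa's `G₁` made explicit), `Winv`, `E` (Bernstein–Vazirani direction erasure), two controlled
  swaps of adjacent cells (the head move; their `G₂`), `LOAD` (input encoding `u(x, K)`), `ACC` (readout)
  and `SWAP`, each a fixed unitary on a CODED finite alphabet (`extendGate` along the binary codes `κΛ`,
  `κΓ`, `binCode` with start state and blank coded by zeros so that fresh ancillas are blank cells) —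
  and proves what gate-set independence (`BQPOver_eq_BQP`) asks of it: finite and encodable alphabet,
  `hcGateSet_isUnitary`, `hcGateSet_isInverseClosed`, `hcGateSet_polyTime` (for well-formed `M` with
  polynomial-time computable amplitudes);
* the wire layout `θ : Idx n ≃ Fin (n + anc n)` on inputs of length `n` (inputs, answer, state code,
  `d`, `e`, `N = 2(n + p(n)) + 3` cell codes), the code `ι` of the head-centred register `HC M N` in the
  wires, the placements `eW, eE, eCS, eLD, eAC, eSW` of the gates, and
* the circuits: `stepGates` (`W`, right word, left word, `E` = one step), `loadGates`, `finalGates`,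
  `hcCirc n = load ++ step^{p(n)} ++ final`, the family `hcFamily M p`, oracle-free
  (`hcFamily_isOracleFree`).

The semantics (`acceptProbOn (hcFamily M p) x = acceptProbAt M x (p |x|)` for every well-formed `M`) is
`QuantumTuringMachineCircuitSemantics.lean`; uniformity is a further file. No named facts are introduced.

## References

* H. Nishimura, M. Ozawa, Theoret. Comput. Sci. 276 (2002) 147–181 = arXiv:quant-ph/9906095
  [NishimuraOzawa2002], §4 (circuits `(G_i, π_i)`, `k`-input `m`-output circuits, encodings `e`, `e_t`,
  `u(x, K)`), Thm. 4.3 and its proof (`l₀ + (2t+1) l` wires; `G₁`, `G₂`; `K = (K_b ∘ K_a)^t`).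
* E. Bernstein, U. Vazirani, SIAM J. Comput. 26 (1997) [BernsteinVazirani1997SICOMP], Lemma 5.5.
-/

noncomputable section

namespace Literature.Computability.Cryptography

open Turing Matrix
open scoped BigOperators

namespace QTM

/-! ### One-hot-difference binary codes of finite types -/

section bincode

variable {T : Type} [Fintype T] [DecidableEq T]

/-- A binary code of a finite type `T` with a distinguished element `t₀ ↦ 0…0`: the bitwise XOR of the
one-hot codes of `t` and of `t₀` (width `|T|`; injective, `binCode_injective`). Nishimura–Ozawa 2002, §4:
"Let `e : Σ → {0,1}^λ … be an injection"; the normalisation `t₀ ↦ 0^λ` lets blank cells and the start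
state be FRESH ancillas. [cite: NishimuraOzawa2002, §4] -/
def binCode (t₀ t : T) : QReg (Fintype.card T) := fun i =>
  xor (decide (Fintype.equivFin T t = i)) (decide (Fintype.equivFin T t₀ = i))

omit [DecidableEq T] in
/-- The distinguished element is coded by the all-zero word. [folklore] -/
theorem binCode_self (t₀ : T) : binCode t₀ t₀ = fun _ => false := by
  funext i
  simp [binCode]

omit [DecidableEq T] in
/-- The code is injective. [folklore] -/
theorem binCode_injective (t₀ : T) : Function.Injective (binCode t₀) := by
  intro t t' h
  have h1 := congrFun h (Fintype.equivFin T t)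
  simp only [binCode, decide_true] at h1
  by_cases h0 : Fintype.equivFin T t₀ = Fintype.equivFin T t
  · rw [decide_eq_true h0] at h1
    by_cases h2 : Fintype.equivFin T t' = Fintype.equivFin T t
    · exact ((Fintype.equivFin T).injective h2).symm
    · rw [decide_eq_false h2] at h1
      simp at h1
  · rw [decide_eq_false h0] at h1
    by_cases h2 : Fintype.equivFin T t' = Fintype.equivFin T t
    · exact ((Fintype.equivFin T).injective h2).symm
    · rw [decide_eq_false h2] at h1
      simp at h1

end bincode

/-! ### Layout parameters -/

section layout

variable (M : QTM) (p : Polynomial ℕ)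

/-- Width of the state code (`= |Λ|`). [folklore] -/
abbrev kΛ : ℕ := Fintype.card M.Λ

/-- Width of the symbol code (`= |Γ|`). [folklore] -/
abbrev kΓ : ℕ := Fintype.card M.Γ

/-- The simulated time `t = p(n)` on inputs of length `n` (the polynomial of `BQPQTMWith`). [folklore] -/
def tm (n : ℕ) : ℕ := p.eval n

/-- The window size `N = 2(n + p(n)) + 3` on inputs of length `n`: the least size allowed by
`QTM.acceptProbAt_eq_hcUnitary` (Nishimura–Ozawa's `2t + 1` cells, plus the input and the radius slack
of the head-relative model). [cite: NishimuraOzawa2002, §4] -/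
def nw (n : ℕ) : ℕ := 2 * (n + tm p n) + 3

/-- The window is non-empty. [folklore] -/
instance nw_neZero (n : ℕ) : NeZero (nw p n) := ⟨by unfold nw; omega⟩

/-- `N ≥ 2`. [folklore] -/
theorem two_le_nw (n : ℕ) : 2 ≤ nw p n := by unfold nw; omega

/-- The input fits in the window: `n < N`. [folklore] -/
theorem lt_nw (n : ℕ) : n < nw p n := by unfold nw; omega

/-- The number of ancilla wires on inputs of length `n`: answer qubit, state code, direction bit, marker
bit, `N` cell codes — `1 + |Λ| + 1 + 1 + N·|Γ|` (Nishimura–Ozawa's `l₀ + (2t+1) l` wires, head-centred).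
[cite: NishimuraOzawa2002, Thm. 4.3 (proof)] -/
def anc (n : ℕ) : ℕ := 1 + M.kΛ + 1 + 1 + nw p n * M.kΓ

/-- Structured index of the ancilla wires: `(((answer ⊕ state bits) ⊕ d) ⊕ e) ⊕ (cell, bit)`. [folklore] -/
abbrev AncIdx (n : ℕ) : Type := (((Fin 1 ⊕ Fin M.kΛ) ⊕ Fin 1) ⊕ Fin 1) ⊕ (Fin (nw p n) × Fin M.kΓ)

/-- Structured index of all wires: input wires `⊕` ancilla wires. [folklore] -/
abbrev Idx (n : ℕ) : Type := Fin n ⊕ M.AncIdx p n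

/-- The ancilla layout: structured ancilla index `≃ Fin anc` (answer at `0`, then state, `d`, `e`, cells row-major). [folklore] -/
def θA (n : ℕ) : M.AncIdx p n ≃ Fin (M.anc p n) :=
  (Equiv.sumCongr ((Equiv.sumCongr ((Equiv.sumCongr finSumFinEquiv (Equiv.refl (Fin 1))).trans
    finSumFinEquiv) (Equiv.refl (Fin 1))).trans finSumFinEquiv) finProdFinEquiv).trans finSumFinEquiv

/-- **The wire layout** `Idx n ≃ Fin (n + anc n)`: inputs first (wire `i` is input bit `i`), then the ancillas. [folklore] -/
def θ (n : ℕ) : M.Idx p n ≃ Fin (n + M.anc p n) :=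
  (Equiv.sumCongr (Equiv.refl (Fin n)) (M.θA p n)).trans finSumFinEquiv

variable {M p} {n : ℕ}

/-- The structured index of input wire `i`. [folklore] -/
def ixIn (i : Fin n) : M.Idx p n := Sum.inl i
/-- The structured index of the answer wire. [folklore] -/
def ixAns : M.Idx p n := Sum.inr (Sum.inl (Sum.inl (Sum.inl (Sum.inl 0))))
/-- The structured index of state-code wire `b`. [folklore] -/
def ixSt (b : Fin M.kΛ) : M.Idx p n := Sum.inr (Sum.inl (Sum.inl (Sum.inl (Sum.inr b))))
/-- The structured index of the direction wire. [folklore] -/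
def ixD : M.Idx p n := Sum.inr (Sum.inl (Sum.inl (Sum.inr 0)))
/-- The structured index of the marker wire. [folklore] -/
def ixE : M.Idx p n := Sum.inr (Sum.inl (Sum.inr 0))
/-- The structured index of bit `b` of window cell `j`. [folklore] -/
def ixCell (j : Fin (nw p n)) (b : Fin M.kΓ) : M.Idx p n := Sum.inr (Sum.inr (j, b))

/-- Every wire is an input, the answer, a state bit, `d`, `e`, or a cell bit. [folklore] -/
theorem idx_cases (z : M.Idx p n) :
    (∃ i, z = ixIn i) ∨ z = ixAns ∨ (∃ b, z = ixSt b) ∨ z = ixD ∨ z = ixE ∨ ∃ j b, z = ixCell j b := by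
  rcases z with i | ((((a | b) | d) | e) | ⟨j, b⟩)
  · exact Or.inl ⟨i, rfl⟩
  · right; left
    have : a = 0 := Subsingleton.elim _ _
    subst this; rfl
  · exact Or.inr (Or.inr (Or.inl ⟨b, rfl⟩))
  · right; right; right; left
    have : d = 0 := Subsingleton.elim _ _
    subst this; rfl
  · right; right; right; right; left
    have : e = 0 := Subsingleton.elim _ _
    subst this; rfl
  · exact Or.inr (Or.inr (Or.inr (Or.inr (Or.inr ⟨j, b, rfl⟩))))

variable (M p)

/-- The state code (`start ↦ 0…0`). [cite: NishimuraOzawa2002, Thm. 4.3 (proof)] -/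
def κΛ : M.Λ → QReg M.kΛ := binCode M.start

/-- The symbol code (`blank ↦ 0…0`). [cite: NishimuraOzawa2002, §4] -/
def κΓ : M.Γ → QReg M.kΓ := binCode default

/-- The state code is injective. [folklore] -/
theorem κΛ_injective : Function.Injective M.κΛ := binCode_injective _

/-- The symbol code is injective. [folklore] -/
theorem κΓ_injective : Function.Injective M.κΓ := binCode_injective _

/-- The start state is coded by zeros (fresh ancillas). [folklore] -/
theorem κΛ_start : M.κΛ M.start = fun _ => false := binCode_self _

/-- The blank is coded by zeros (fresh ancillas). [folklore] -/
theorem κΓ_default : M.κΓ default = fun _ => false := binCode_self _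

/-- The window position (in `ZMod N`) of cell block `j < N`. [folklore] -/
def cellOf (n : ℕ) (j : Fin (nw p n)) : ZMod (nw p n) := (j.val : ZMod (nw p n))

/-- Distinct blocks are distinct window positions. [folklore] -/
theorem cellOf_injective (n : ℕ) : Function.Injective (cellOf p n) := fun j j' h =>
  Fin.ext (natCast_zmod_inj j.2 j'.2 h)

/-- Every window position has a block. [folklore] -/
theorem cellOf_surjective (n : ℕ) : Function.Surjective (cellOf p n) := fun i =>
  ⟨⟨i.val, ZMod.val_lt i⟩, ZMod.natCast_zmod_val i⟩

/-- The bit carried by each wire when the register holds the head-centred basis state `r`, the input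
wires hold `x` and the answer wire holds `a`: Nishimura–Ozawa's encoded configuration
`|q; T(-t)…; T(0)…; …⟩`, head-centred. [cite: NishimuraOzawa2002, §4 and Thm. 4.3 (proof)] -/
def idxVal (n : ℕ) (x : Fin n → Bool) (a : Bool) (r : M.HC (nw p n)) : M.Idx p n → Bool :=
  Sum.elim (fun i => x i)
    (Sum.elim (Sum.elim (Sum.elim (Sum.elim (fun _ => a) (fun b => M.κΛ r.1 b))
      (fun _ => r.2.2.1)) (fun _ => r.2.2.2))
      (fun jb => M.κΓ (r.2.1 (cellOf p n jb.1)) jb.2))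

/-- **The code of the head-centred register in the wires** (`idxVal` transported along the layout `θ`). [cite: NishimuraOzawa2002, §4] -/
def ι (n : ℕ) (x : Fin n → Bool) (a : Bool) (r : M.HC (nw p n)) : QReg (n + M.anc p n) :=
  M.idxVal p n x a r ∘ (M.θ p n).symm

variable {M p}

/-- Input wires carry the input. [folklore] -/
@[simp] theorem idxVal_ixIn (x : Fin n → Bool) (a : Bool) (r : M.HC (nw p n)) (i : Fin n) :
    M.idxVal p n x a r (ixIn i) = x i := rfl
/-- The answer wire carries the answer bit. [folklore] -/
@[simp] theorem idxVal_ixAns (x : Fin n → Bool) (a : Bool) (r : M.HC (nw p n)) :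
    M.idxVal p n x a r ixAns = a := rfl
/-- State wires carry the state code. [folklore] -/
@[simp] theorem idxVal_ixSt (x : Fin n → Bool) (a : Bool) (r : M.HC (nw p n)) (b : Fin M.kΛ) :
    M.idxVal p n x a r (ixSt b) = M.κΛ r.1 b := rfl
/-- The direction wire carries `d`. [folklore] -/
@[simp] theorem idxVal_ixD (x : Fin n → Bool) (a : Bool) (r : M.HC (nw p n)) :
    M.idxVal p n x a r ixD = r.2.2.1 := rfl
/-- The marker wire carries `e`. [folklore] -/
@[simp] theorem idxVal_ixE (x : Fin n → Bool) (a : Bool) (r : M.HC (nw p n)) :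
    M.idxVal p n x a r ixE = r.2.2.2 := rfl
/-- Cell wires carry the symbol codes of the window. [folklore] -/
@[simp] theorem idxVal_ixCell (x : Fin n → Bool) (a : Bool) (r : M.HC (nw p n)) (j : Fin (nw p n)) (b : Fin M.kΓ) :
    M.idxVal p n x a r (ixCell j b) = M.κΓ (r.2.1 (cellOf p n j)) b := rfl

/-- Reading a wire of the code through the layout. [folklore] -/
@[simp] theorem ι_apply_θ (x : Fin n → Bool) (a : Bool) (r : M.HC (nw p n)) (z : M.Idx p n) :
    M.ι p n x a r (M.θ p n z) = M.idxVal p n x a r z := by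
  simp [ι]

/-- The code is injective (for fixed input and answer bit). [folklore] -/
theorem ι_injective (x : Fin n → Bool) (a : Bool) : Function.Injective (M.ι p n x a) := by
  intro r r' h
  have hz : ∀ z, M.idxVal p n x a r z = M.idxVal p n x a r' z := fun z => by
    have := congrFun h (M.θ p n z)
    simpa using this
  obtain ⟨q, w, d, e⟩ := r
  obtain ⟨q', w', d', e'⟩ := r'
  have hq : q = q' := M.κΛ_injective (funext fun b => hz (ixSt b))
  have hd : d = d' := hz ixD
  have he : e = e' := hz ixE
  have hw : w = w' := by
    funext i
    obtain ⟨j, rfl⟩ := cellOf_surjective p n i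
    exact M.κΓ_injective (funext fun b => hz (ixCell j b))
  rw [hq, hd, he, hw]

end layout

/-! ### The gate set -/

section gates

variable (M : QTM)

/-- The machine-specific gate symbols: local step `W` and its inverse `Winv`, erasure `E`, the two
controlled cell swaps `CS b`, input loading `LOAD`, acceptance readout `ACC`, and `SWAP`. [cite: NishimuraOzawa2002, Thm. 4.3 (proof)] -/
inductive HCOp
  | W
  | Winv
  | E
  | CS (b : Bool)
  | LOAD
  | ACC
  | SWAP
  deriving DecidableEq

/-- There are finitely many machine-specific gate symbols. [folklore] -/
instance : Fintype HCOp where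
  elems := {HCOp.W, HCOp.Winv, HCOp.E, HCOp.CS true, HCOp.CS false, HCOp.LOAD, HCOp.ACC, HCOp.SWAP}
  complete := by intro g; rcases g with _ | _ | _ | (_ | _) | _ | _ | _ <;> simp

/-- Numbering of the gate symbols. [folklore] -/
def HCOp.toFin : HCOp → Fin 8
  | .W => 0 | .Winv => 1 | .E => 2 | .CS true => 3 | .CS false => 4 | .LOAD => 5 | .ACC => 6 | .SWAP => 7

/-- Gate symbols from their numbers. [folklore] -/
def HCOp.ofFin : Fin 8 → HCOp
  | 0 => .W | 1 => .Winv | 2 => .E | 3 => .CS true | 4 => .CS false | 5 => .LOAD | 6 => .ACC | 7 => .SWAP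

/-- The gate symbols are encodable (needed for circuit descriptions). [folklore] -/
instance : Encodable HCOp :=
  Encodable.ofLeftInverse HCOp.toFin HCOp.ofFin (by intro g; rcases g with _ | _ | _ | (_ | _) | _ | _ | _ <;> rfl)

/-! #### Local index types, local codes -/

/-- Structured pins of the local step gate: `((state ⊕ symbol) ⊕ d) ⊕ e`. [folklore] -/
abbrev LocIdx : Type := ((Fin M.kΛ ⊕ Fin M.kΓ) ⊕ Fin 1) ⊕ Fin 1
/-- Structured pins of the erasure gate: `(state ⊕ d) ⊕ e`. [folklore] -/
abbrev ErIdx : Type := (Fin M.kΛ ⊕ Fin 1) ⊕ Fin 1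
/-- Structured pins of a controlled cell swap: `(d ⊕ cell) ⊕ cell`. [folklore] -/
abbrev CSIdx : Type := (Fin 1 ⊕ Fin M.kΓ) ⊕ Fin M.kΓ
/-- Structured pins of the load gate: `input bit ⊕ cell`. [folklore] -/
abbrev LDIdx : Type := Fin 1 ⊕ Fin M.kΓ
/-- Structured pins of the readout gate: `state ⊕ answer`. [folklore] -/
abbrev ACIdx : Type := Fin M.kΛ ⊕ Fin 1

/-- Pin numbering of the local step gate. [folklore] -/
def θLoc : M.LocIdx ≃ Fin (M.kΛ + M.kΓ + 1 + 1) :=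
  (Equiv.sumCongr ((Equiv.sumCongr finSumFinEquiv (Equiv.refl _)).trans finSumFinEquiv) (Equiv.refl _)).trans
    finSumFinEquiv
/-- Pin numbering of the erasure gate. [folklore] -/
def θEr : M.ErIdx ≃ Fin (M.kΛ + 1 + 1) :=
  (Equiv.sumCongr finSumFinEquiv (Equiv.refl _)).trans finSumFinEquiv
/-- Pin numbering of the controlled swap gate. [folklore] -/
def θCS : M.CSIdx ≃ Fin (1 + M.kΓ + M.kΓ) :=
  (Equiv.sumCongr finSumFinEquiv (Equiv.refl _)).trans finSumFinEquiv
/-- Pin numbering of the load gate. [folklore] -/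
def θLD : M.LDIdx ≃ Fin (1 + M.kΓ) := finSumFinEquiv
/-- Pin numbering of the readout gate. [folklore] -/
def θAC : M.ACIdx ≃ Fin (M.kΛ + 1) := finSumFinEquiv

/-- Pin values of the local register code `(q, σ, d, e)`. [folklore] -/
def locVal (a : M.Loc) : M.LocIdx → Bool :=
  Sum.elim (Sum.elim (Sum.elim (fun b => M.κΛ a.1 b) (fun b => M.κΓ a.2.1 b)) (fun _ => a.2.2.1)) (fun _ => a.2.2.2)
/-- Pin values of the erasure register code `(q, d, e)`. [folklore] -/
def erVal (a : M.Er) : M.ErIdx → Bool :=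
  Sum.elim (Sum.elim (fun b => M.κΛ a.1 b) (fun _ => a.2.1)) (fun _ => a.2.2)
/-- Pin values of the controlled-swap alphabet `(d, γ₁, γ₂)`. [folklore] -/
def csVal (a : Bool × M.Γ × M.Γ) : M.CSIdx → Bool :=
  Sum.elim (Sum.elim (fun _ => a.1) (fun b => M.κΓ a.2.1 b)) (fun b => M.κΓ a.2.2 b)
/-- Pin values of the load alphabet `(b, γ)`. [folklore] -/
def ldVal (a : Bool × M.Γ) : M.LDIdx → Bool :=
  Sum.elim (fun _ => a.1) (fun b => M.κΓ a.2 b)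
/-- Pin values of the readout alphabet `(q, a)`. [folklore] -/
def acVal (a : M.Λ × Bool) : M.ACIdx → Bool :=
  Sum.elim (fun b => M.κΛ a.1 b) (fun _ => a.2)

/-- The binary code of the local register `Λ × Γ × Bool × Bool` on the pins of `W`. [cite: NishimuraOzawa2002, Thm. 4.3 (proof)] -/
def κLoc (a : M.Loc) : QReg (M.kΛ + M.kΓ + 1 + 1) := M.locVal a ∘ M.θLoc.symm
/-- The binary code of the erasure register on the pins of `E`. [folklore] -/
def κEr (a : M.Er) : QReg (M.kΛ + 1 + 1) := M.erVal a ∘ M.θEr.symm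
/-- The binary code of the controlled-swap alphabet. [folklore] -/
def κCS (a : Bool × M.Γ × M.Γ) : QReg (1 + M.kΓ + M.kΓ) := M.csVal a ∘ M.θCS.symm
/-- The binary code of the load alphabet. [folklore] -/
def κLD (a : Bool × M.Γ) : QReg (1 + M.kΓ) := M.ldVal a ∘ M.θLD.symm
/-- The binary code of the readout alphabet. [folklore] -/
def κAC (a : M.Λ × Bool) : QReg (M.kΛ + 1) := M.acVal a ∘ M.θAC.symm

/-- The local code is injective. [folklore] -/
theorem κLoc_injective : Function.Injective M.κLoc := by
  intro a a' h
  have hz : ∀ z, M.locVal a z = M.locVal a' z := fun z => by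
    have := congrFun h (M.θLoc z); simpa [κLoc] using this
  obtain ⟨q, σ, d, e⟩ := a
  obtain ⟨q', σ', d', e'⟩ := a'
  have hq : q = q' := M.κΛ_injective (funext fun b => hz (Sum.inl (Sum.inl (Sum.inl b))))
  have hσ : σ = σ' := M.κΓ_injective (funext fun b => hz (Sum.inl (Sum.inl (Sum.inr b))))
  have hd : d = d' := hz (Sum.inl (Sum.inr 0))
  have he : e = e' := hz (Sum.inr 0)
  rw [hq, hσ, hd, he]

/-- The erasure code is injective. [folklore] -/
theorem κEr_injective : Function.Injective M.κEr := by
  intro a a' h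
  have hz : ∀ z, M.erVal a z = M.erVal a' z := fun z => by
    have := congrFun h (M.θEr z); simpa [κEr] using this
  obtain ⟨q, d, e⟩ := a
  obtain ⟨q', d', e'⟩ := a'
  have hq : q = q' := M.κΛ_injective (funext fun b => hz (Sum.inl (Sum.inl b)))
  have hd : d = d' := hz (Sum.inl (Sum.inr 0))
  have he : e = e' := hz (Sum.inr 0)
  rw [hq, hd, he]

/-- The controlled-swap code is injective. [folklore] -/
theorem κCS_injective : Function.Injective M.κCS := by
  intro a a' h
  have hz : ∀ z, M.csVal a z = M.csVal a' z := fun z => by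
    have := congrFun h (M.θCS z); simpa [κCS] using this
  obtain ⟨d, g₁, g₂⟩ := a
  obtain ⟨d', g₁', g₂'⟩ := a'
  have hd : d = d' := hz (Sum.inl (Sum.inl 0))
  have h1 : g₁ = g₁' := M.κΓ_injective (funext fun b => hz (Sum.inl (Sum.inr b)))
  have h2 : g₂ = g₂' := M.κΓ_injective (funext fun b => hz (Sum.inr b))
  rw [hd, h1, h2]

/-- The load code is injective. [folklore] -/
theorem κLD_injective : Function.Injective M.κLD := by
  intro a a' h
  have hz : ∀ z, M.ldVal a z = M.ldVal a' z := fun z => by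
    have := congrFun h (M.θLD z); simpa [κLD] using this
  obtain ⟨d, g⟩ := a
  obtain ⟨d', g'⟩ := a'
  have hd : d = d' := hz (Sum.inl 0)
  have h1 : g = g' := M.κΓ_injective (funext fun b => hz (Sum.inr b))
  rw [hd, h1]

/-- The readout code is injective. [folklore] -/
theorem κAC_injective : Function.Injective M.κAC := by
  intro a a' h
  have hz : ∀ z, M.acVal a z = M.acVal a' z := fun z => by
    have := congrFun h (M.θAC z); simpa [κAC] using this
  obtain ⟨q, d⟩ := a
  obtain ⟨q', d'⟩ := a'
  have hq : q = q' := M.κΛ_injective (funext fun b => hz (Sum.inl b))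
  have hd : d = d' := hz (Sum.inr 0)
  rw [hq, hd]

/-! #### The classical local permutations -/

/-- The controlled swap of two symbols: `(d, γ₁, γ₂) ↦ (d, γ₂, γ₁)` if `d = b`, identity otherwise. [cite: NishimuraOzawa2002, Thm. 4.3 (proof, gate G₂)] -/
def csPerm (b : Bool) : Equiv.Perm (Bool × M.Γ × M.Γ) where
  toFun a := (a.1, if a.1 = b then (a.2.2, a.2.1) else a.2)
  invFun a := (a.1, if a.1 = b then (a.2.2, a.2.1) else a.2)
  left_inv := by rintro ⟨d, g₁, g₂⟩; by_cases h : d = b <;> simp [h]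
  right_inv := by rintro ⟨d, g₁, g₂⟩; by_cases h : d = b <;> simp [h]

/-- Action of the controlled symbol swap (definitional). [folklore] -/
theorem csPerm_apply (b : Bool) (a : Bool × M.Γ × M.Γ) :
    M.csPerm b a = (a.1, if a.1 = b then (a.2.2, a.2.1) else a.2) := rfl

/-- The controlled symbol swap is an involution. [folklore] -/
theorem csPerm_mul_self (b : Bool) : M.csPerm b * M.csPerm b = 1 := by
  ext1 a; exact (M.csPerm b).left_inv a

/-- Input loading: `(b, γ) ↦ (b, (blank ↔ embed b) γ)` — exchanges the blank with the tape symbol of the input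
bit `b`, so that a fresh cell becomes `embed b` (Nishimura–Ozawa's input encoding `u(x, K)`, §4). [cite: NishimuraOzawa2002, §4] -/
def loadPerm : Equiv.Perm (Bool × M.Γ) where
  toFun a := (a.1, Equiv.swap default (M.embed a.1) a.2)
  invFun a := (a.1, Equiv.swap default (M.embed a.1) a.2)
  left_inv := by rintro ⟨d, g⟩; simp
  right_inv := by rintro ⟨d, g⟩; simp

/-- Action of the load permutation (definitional). [folklore] -/
theorem loadPerm_apply (a : Bool × M.Γ) : M.loadPerm a = (a.1, Equiv.swap default (M.embed a.1) a.2) := rfl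

/-- Loading is an involution. [folklore] -/
theorem loadPerm_mul_self : M.loadPerm * M.loadPerm = 1 := by
  ext1 a; exact M.loadPerm.left_inv a

/-- Readout: `(q, a) ↦ (q, a ⊕ [q = accept])` — copies the predicate "state = accepting" into the answer
bit (the tree measures wire `0`, `QCircuit.acceptProb`; Nishimura–Ozawa measure specified wires, §4). [cite: NishimuraOzawa2002, §4] -/
def accPerm : Equiv.Perm (M.Λ × Bool) where
  toFun a := (a.1, xor a.2 (decide (a.1 = M.accept)))
  invFun a := (a.1, xor a.2 (decide (a.1 = M.accept)))
  left_inv := by rintro ⟨q, a⟩; simp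
  right_inv := by rintro ⟨q, a⟩; simp

/-- Action of the readout permutation (definitional). [folklore] -/
theorem accPerm_apply (a : M.Λ × Bool) : M.accPerm a = (a.1, xor a.2 (decide (a.1 = M.accept))) := rfl

/-- Readout is an involution. [folklore] -/
theorem accPerm_mul_self : M.accPerm * M.accPerm = 1 := by
  ext1 a; exact M.accPerm.left_inv a

/-- The swap of two qubits as a permutation of `{0,1}²`. [folklore] -/
def swapPerm : Equiv.Perm (QReg 2) where
  toFun y := y ∘ Equiv.swap 0 1
  invFun y := y ∘ Equiv.swap 0 1
  left_inv y := by funext i; simp [Equiv.swap_apply_self]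
  right_inv y := by funext i; simp [Equiv.swap_apply_self]

/-- Swapping is an involution. [folklore] -/
theorem swapPerm_mul_self : swapPerm * swapPerm = 1 := by
  ext1 y; exact swapPerm.left_inv y

/-! #### Arities and matrices -/

/-- Arities of the machine-specific gates (`|Λ|+|Γ|+2`, `|Λ|+2`, `1+2|Γ|`, `1+|Γ|`, `|Λ|+1`, `2`). [folklore] -/
def hcArity : HCOp → ℕ
  | .W => M.kΛ + M.kΓ + 1 + 1
  | .Winv => M.kΛ + M.kΓ + 1 + 1
  | .E => M.kΛ + 1 + 1
  | .CS _ => 1 + M.kΓ + M.kΓ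
  | .LOAD => 1 + M.kΓ
  | .ACC => M.kΛ + 1
  | .SWAP => 2

/-- Matrices of the machine-specific gates: `wMat`, `wMatᴴ`, `eMat` extended from their coded alphabets
(`extendGate`), and the permutation gates. [cite: NishimuraOzawa2002, Thm. 4.3 (proof)] -/
def hcMat : (g : HCOp) → Matrix (QReg (M.hcArity g)) (QReg (M.hcArity g)) ℂ
  | .W => extendGate M.κLoc M.wMat
  | .Winv => extendGate M.κLoc M.wMatᴴ
  | .E => extendGate M.κEr M.eMat
  | .CS b => extendGate M.κCS (permMat (M.csPerm b))
  | .LOAD => extendGate M.κLD (permMat M.loadPerm)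
  | .ACC => extendGate M.κAC (permMat M.accPerm)
  | .SWAP => permMat swapPerm

/-- **The gate set `𝒢_M` of the simulation**: Clifford+`T` together with the (at most eight) machine-specific
gates — finite, unitary (`hcGateSet_isUnitary`), inverse-closed (`hcGateSet_isInverseClosed`), universal because it
contains Clifford+`T`, with polynomial-time computable entries when `M` has (`hcGateSet_polyTime`): the
hypotheses of gate-set independence `BQPOver_eq_BQP`. Nishimura–Ozawa instead decompose `G₁`, `G₂` into
`𝒢_u`-gates at once (proof of Thm. 4.3, last paragraph); here the decomposition is deferred to `BQPOver_eq_BQP`.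
[cite: NishimuraOzawa2002, Thm. 4.3 (proof)] -/
def hcGateSet : QGateSet where
  Op := CliffordTOp ⊕ HCOp
  arity := Sum.elim cliffordT.arity M.hcArity
  mat g := match g with
    | .inl g => cliffordT.mat g
    | .inr g => M.hcMat g

/-- The gate alphabet is finite. [folklore] -/
instance : Finite M.hcGateSet.Op := inferInstanceAs (Finite (CliffordTOp ⊕ HCOp))

/-- The gate alphabet is encodable. [folklore] -/
instance : Encodable M.hcGateSet.Op := inferInstanceAs (Encodable (CliffordTOp ⊕ HCOp))



/-! #### Properties of the gate set -/

/-- Every machine-specific gate of a well-formed machine is unitary. [folklore] -/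
theorem hcMat_mem_unitaryGroup (hwf : M.IsWellFormed) (g : HCOp) :
    M.hcMat g ∈ Matrix.unitaryGroup (QReg (M.hcArity g)) ℂ := by
  cases g with
  | W => exact extendGate_mem_unitaryGroup M.κLoc_injective (M.wMat_mem_unitaryGroup hwf)
  | Winv =>
    refine extendGate_mem_unitaryGroup M.κLoc_injective ?_
    rw [← star_eq_conjTranspose]
    exact Unitary.star_mem (M.wMat_mem_unitaryGroup hwf)
  | E => exact extendGate_mem_unitaryGroup M.κEr_injective (M.eMat_mem_unitaryGroup hwf)
  | CS b => exact extendGate_mem_unitaryGroup M.κCS_injective (permMat_mem_unitaryGroup _)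
  | LOAD => exact extendGate_mem_unitaryGroup M.κLD_injective (permMat_mem_unitaryGroup _)
  | ACC => exact extendGate_mem_unitaryGroup M.κAC_injective (permMat_mem_unitaryGroup _)
  | SWAP => exact permMat_mem_unitaryGroup _

/-- **`𝒢_M` is a unitary gate set** for well-formed `M`. [cite: NishimuraOzawa2002, Thm. 4.3] -/
theorem hcGateSet_isUnitary (hwf : M.IsWellFormed) : M.hcGateSet.IsUnitary := by
  rintro (g | g)
  · exact cliffordT_isUnitary_holds g
  · exact M.hcMat_mem_unitaryGroup hwf g

/-- Clifford+`T` placements are `𝒢_M` placements. [folklore] -/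
theorem placements_cliffordT_subset (n : ℕ) : placements cliffordT n ⊆ placements M.hcGateSet n := by
  rintro _ ⟨g, e, rfl⟩
  exact ⟨Sum.inl g, e, rfl⟩

/-- All machine gates other than `W`, `Winv` are involutions. [folklore] -/
theorem hcMat_involutive (g : HCOp) (hg : g ≠ HCOp.W) (hg' : g ≠ HCOp.Winv) (hwf : M.IsWellFormed) :
    M.hcMat g * M.hcMat g = 1 := by
  cases g with
  | W => exact absurd rfl hg
  | Winv => exact absurd rfl hg'
  | E =>
    change extendGate M.κEr M.eMat * extendGate M.κEr M.eMat = 1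
    exact extendGate_mul_self_of M.κEr_injective (M.eMat_mul_self hwf)
  | CS b =>
    change extendGate M.κCS (permMat (M.csPerm b)) * extendGate M.κCS (permMat (M.csPerm b)) = 1
    exact extendGate_mul_self_of M.κCS_injective (by rw [← permMat_mul, csPerm_mul_self, permMat_one])
  | LOAD =>
    change extendGate M.κLD (permMat M.loadPerm) * extendGate M.κLD (permMat M.loadPerm) = 1
    exact extendGate_mul_self_of M.κLD_injective (by rw [← permMat_mul, loadPerm_mul_self, permMat_one])
  | ACC =>
    change extendGate M.κAC (permMat M.accPerm) * extendGate M.κAC (permMat M.accPerm) = 1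
    exact extendGate_mul_self_of M.κAC_injective (by rw [← permMat_mul, accPerm_mul_self, permMat_one])
  | SWAP =>
    change permMat swapPerm * permMat swapPerm = 1
    rw [← permMat_mul, swapPerm_mul_self, permMat_one]

/-- `Winv · W = 1`. [folklore] -/
theorem hcMat_winv_mul_w (hwf : M.IsWellFormed) : extendGate M.κLoc M.wMatᴴ * extendGate M.κLoc M.wMat = 1 := by
  have hU := M.wMat_mem_unitaryGroup hwf
  rw [Matrix.mem_unitaryGroup_iff', star_eq_conjTranspose] at hU
  rw [← extendGate_mul M.κLoc_injective, hU, extendGate_one M.κLoc_injective]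

/-- `W · Winv = 1`. [folklore] -/
theorem hcMat_w_mul_winv (hwf : M.IsWellFormed) : extendGate M.κLoc M.wMat * extendGate M.κLoc M.wMatᴴ = 1 := by
  have hU := M.wMat_mem_unitaryGroup hwf
  rw [Matrix.mem_unitaryGroup_iff, star_eq_conjTranspose] at hU
  rw [← extendGate_mul M.κLoc_injective, hU, extendGate_one M.κLoc_injective]

/-- **`𝒢_M` is inverse-closed** (Clifford+`T` is, `W ↔ Winv`, the rest are involutions). [folklore] -/
theorem hcGateSet_isInverseClosed (hwf : M.IsWellFormed) : M.hcGateSet.IsInverseClosed := by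
  intro n P hP
  obtain ⟨g, e, rfl⟩ := hP
  have pair : ∀ (k : ℕ) (e : Fin k ↪ Fin n) (U V : Matrix (QReg k) (QReg k) ℂ), U * V = 1 →
      placeGate e U * placeGate e V = 1 := by
    intro k e U V h
    rw [← placeGate_mul_holds, h, placeGate_one]
  rcases g with g | g
  · obtain ⟨l, hl, hprod⟩ :=
      _root_.Literature.Computability.QuantumComplexity.cliffordT_isInverseClosed n
        (placeGate e (cliffordT.mat g)) ⟨g, e, rfl⟩
    exact ⟨l, fun N hN => M.placements_cliffordT_subset n (hl N hN), hprod⟩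
  · by_cases hW : g = HCOp.W
    · subst hW
      refine ⟨[placeGate e (M.hcGateSet.mat (Sum.inr HCOp.Winv))], ?_, ?_⟩
      · intro N hN
        rw [List.mem_singleton] at hN
        subst hN
        exact ⟨Sum.inr HCOp.Winv, e, rfl⟩
      · rw [List.prod_singleton]
        exact pair _ e _ _ (M.hcMat_winv_mul_w hwf)
    by_cases hWi : g = HCOp.Winv
    · subst hWi
      refine ⟨[placeGate e (M.hcGateSet.mat (Sum.inr HCOp.W))], ?_, ?_⟩
      · intro N hN
        rw [List.mem_singleton] at hN
        subst hN
        exact ⟨Sum.inr HCOp.W, e, rfl⟩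
      · rw [List.prod_singleton]
        exact pair _ e _ _ (M.hcMat_w_mul_winv hwf)
    refine ⟨[placeGate e (M.hcGateSet.mat (Sum.inr g))], ?_, ?_⟩
    · intro N hN
      rw [List.mem_singleton] at hN
      subst hN
      exact ⟨Sum.inr g, e, rfl⟩
    · rw [List.prod_singleton]
      exact pair _ e _ _ (M.hcMat_involutive g hW hWi hwf)

/-- Entries of permutation matrices are `0` or `1`. [folklore] -/
theorem permMat_apply_mem {X : Type*} [Fintype X] [DecidableEq X] (σ : Equiv.Perm X) (S : Set ℂ)
    (h0 : (0 : ℂ) ∈ S) (h1 : (1 : ℂ) ∈ S) (a b : X) : permMat σ a b ∈ S := by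
  rw [permMat_apply]
  split_ifs
  exacts [h1, h0]

/-- **`𝒢_M` has polynomial-time computable entries** when `M.amplitudes ⊆ polyTimeComputableComplex`
(Clifford+`T`: `cliffordT_polyTimeEntries`; `W`, `E`: `wMat_polyTime`, `eMat_polyTime`; permutations: `0/1`).
[cite: NishimuraOzawa2002, §4] -/
theorem hcGateSet_polyTime (h : M.amplitudes ⊆ polyTimeComputableComplex) :
    ∀ (g : M.hcGateSet.Op) (i j : QReg (M.hcGateSet.arity g)), M.hcGateSet.mat g i j ∈ polyTimeComputableComplex := by
  have h0 : (0 : ℂ) ∈ polyTimeComputableComplex := polyTimeComputableSubfield.zero_mem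
  have h1 : (1 : ℂ) ∈ polyTimeComputableComplex := polyTimeComputableSubfield.one_mem
  rintro (g | g) i j
  · exact cliffordT_polyTimeEntries g i j
  · cases g with
    | W =>
      change extendGate M.κLoc M.wMat i j ∈ _
      exact extendGate_apply_mem _ _ h0 h1 (M.wMat_polyTime h) M.κLoc_injective i j
    | Winv =>
      change extendGate M.κLoc M.wMatᴴ i j ∈ _
      exact extendGate_apply_mem _ _ h0 h1 (M.wMat_conjTranspose_polyTime h) M.κLoc_injective i j
    | E =>
      change extendGate M.κEr M.eMat i j ∈ _
      exact extendGate_apply_mem _ _ h0 h1 (M.eMat_polyTime h) M.κEr_injective i j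
    | CS b =>
      change extendGate M.κCS (permMat (M.csPerm b)) i j ∈ _
      exact extendGate_apply_mem _ _ h0 h1 (permMat_apply_mem _ _ h0 h1) M.κCS_injective i j
    | LOAD =>
      change extendGate M.κLD (permMat M.loadPerm) i j ∈ _
      exact extendGate_apply_mem _ _ h0 h1 (permMat_apply_mem _ _ h0 h1) M.κLD_injective i j
    | ACC =>
      change extendGate M.κAC (permMat M.accPerm) i j ∈ _
      exact extendGate_apply_mem _ _ h0 h1 (permMat_apply_mem _ _ h0 h1) M.κAC_injective i j
    | SWAP =>
      change permMat swapPerm i j ∈ _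
      exact permMat_apply_mem _ _ h0 h1 i j

end gates

/-! ### Wire embeddings and the circuit family -/

section circuit

variable (M : QTM) (p : Polynomial ℕ) (n : ℕ)

/-- Cell block number `j < N` as an element of `Fin N`. [folklore] -/
def cellAt (j : ℕ) (hj : j < nw p n) : Fin (nw p n) := ⟨j, hj⟩

/-- The scanned cell (block `0`). [folklore] -/
def cell0 : Fin (nw p n) := ⟨0, Nat.pos_of_ne_zero (NeZero.ne _)⟩

variable {M p n} in
/-- Distinct state bits are distinct wires. [folklore] -/
theorem ixSt_injective : Function.Injective (ixSt : Fin M.kΛ → M.Idx p n) := fun b b' h => by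
  simpa [ixSt] using h

variable {M p n} in
/-- Distinct cell bits are distinct wires. [folklore] -/
theorem ixCell_injective : Function.Injective (fun jb : Fin (nw p n) × Fin M.kΓ => (ixCell jb.1 jb.2 : M.Idx p n)) :=
  fun jb jb' h => by
    obtain ⟨j, b⟩ := jb
    obtain ⟨j', b'⟩ := jb'
    simp only [ixCell, Sum.inr.injEq, Prod.mk.injEq] at h
    rw [h.1, h.2]

variable {M p n} in
/-- Distinct input bits are distinct wires. [folklore] -/
theorem ixIn_injective : Function.Injective (ixIn : Fin n → M.Idx p n) := fun i i' h => by
  simpa [ixIn] using h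

/-- The wires of the local step gate: state, cell `0`, `d`, `e` (the head is pinned at cell `0`). [cite: NishimuraOzawa2002, Thm. 4.3 (proof)] -/
def locWires : M.LocIdx → M.Idx p n :=
  Sum.elim (Sum.elim (Sum.elim ixSt (fun b => ixCell (cell0 p n) b)) (fun _ => ixD)) (fun _ => ixE)

/-- The wires of the erasure gate: state, `d`, `e`. [folklore] -/
def erWires : M.ErIdx → M.Idx p n := Sum.elim (Sum.elim ixSt (fun _ => ixD)) (fun _ => ixE)

/-- The wires of the controlled swap of cell blocks `j₁ ≠ j₂`: `d` and the two blocks. [folklore] -/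
def csWires (j₁ j₂ : ℕ) (h₁ : j₁ < nw p n) (h₂ : j₂ < nw p n) : M.CSIdx → M.Idx p n :=
  Sum.elim (Sum.elim (fun _ => ixD) (fun b => ixCell (cellAt p n j₁ h₁) b))
    (fun b => ixCell (cellAt p n j₂ h₂) b)

/-- The wires of the load gate for input bit `i`: input wire `i` and cell block `i`. [folklore] -/
def ldWires (i : Fin n) : M.LDIdx → M.Idx p n :=
  Sum.elim (fun _ => ixIn i) (fun b => ixCell (cellAt p n i.val (i.2.trans (lt_nw p n))) b)

/-- The wires of the readout gate: state and answer. [folklore] -/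
def acWires : M.ACIdx → M.Idx p n := Sum.elim ixSt (fun _ => ixAns)

/-- Wire number `k ≤ n` as a structured index: input wire `k` for `k < n`, the answer wire for `k = n`. [folklore] -/
def wireAt (k : ℕ) : M.Idx p n := if h : k < n then ixIn ⟨k, h⟩ else ixAns

/-- The wires of the `k`-th final swap: wire `0` and wire `k + 1` (`k < n`). [folklore] -/
def swWires (k : Fin n) : Fin 2 → M.Idx p n := fun i => if i = 0 then M.wireAt p n 0 else M.wireAt p n (k.val + 1)

/-- The local step gate uses distinct wires. [folklore] -/
theorem locWires_injective : Function.Injective (M.locWires p n) := by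
  rintro (((b | b) | d) | e) (((b' | b') | d') | e') h <;>
    simp [locWires, ixSt, ixCell, ixD, ixE] at h ⊢ <;>
    first | exact h | exact Subsingleton.elim _ _

/-- The erasure gate uses distinct wires. [folklore] -/
theorem erWires_injective : Function.Injective (M.erWires p n) := by
  rintro ((b | d) | e) ((b' | d') | e') h <;>
    simp [erWires, ixSt, ixD, ixE] at h ⊢ <;>
    first | exact h | exact Subsingleton.elim _ _

/-- A controlled swap uses distinct wires. [folklore] -/
theorem csWires_injective (j₁ j₂ : ℕ) (h₁ : j₁ < nw p n) (h₂ : j₂ < nw p n) (hne : j₁ ≠ j₂) :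
    Function.Injective (M.csWires p n j₁ j₂ h₁ h₂) := by
  rintro ((d | b) | b) ((d' | b') | b') h <;>
    simp [csWires, ixCell, ixD, cellAt] at h ⊢ <;>
    first | exact h | exact Subsingleton.elim _ _ | exact absurd h.1 hne | exact absurd h.1.symm hne

/-- A load gate uses distinct wires. [folklore] -/
theorem ldWires_injective (i : Fin n) : Function.Injective (M.ldWires p n i) := by
  rintro (d | b) (d' | b') h <;>
    simp [ldWires, ixCell, ixIn, cellAt] at h ⊢ <;>
    first | exact h | exact Subsingleton.elim _ _

/-- The readout gate uses distinct wires. [folklore] -/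
theorem acWires_injective : Function.Injective (M.acWires p n) := by
  rintro (b | a) (b' | a') h <;>
    simp [acWires, ixSt, ixAns] at h ⊢ <;>
    first | exact h | exact Subsingleton.elim _ _

/-- Distinct wire numbers `≤ n` are distinct structured indices. [folklore] -/
theorem wireAt_injective {k k' : ℕ} (hk : k ≤ n) (hk' : k' ≤ n) (h : M.wireAt p n k = M.wireAt p n k') : k = k' := by
  unfold wireAt at h
  by_cases h1 : k < n <;> by_cases h2 : k' < n
  · rw [dif_pos h1, dif_pos h2] at h
    simpa [ixIn] using h
  · rw [dif_pos h1, dif_neg h2] at h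
    simp [ixIn, ixAns] at h
  · rw [dif_neg h1, dif_pos h2] at h
    simp [ixIn, ixAns] at h
  · omega

/-- A final swap uses distinct wires. [folklore] -/
theorem swWires_injective (k : Fin n) : Function.Injective (M.swWires p n k) := by
  intro i i' h
  fin_cases i <;> fin_cases i'
  · rfl
  · have h' : M.wireAt p n 0 = M.wireAt p n (k.val + 1) := by simpa [swWires] using h
    exact absurd (M.wireAt_injective p n (Nat.zero_le n) k.2 h') (by omega)
  · have h' : M.wireAt p n (k.val + 1) = M.wireAt p n 0 := by simpa [swWires] using h
    exact absurd (M.wireAt_injective p n k.2 (Nat.zero_le n) h') (by omega)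
  · rfl

/-- A wire embedding `Fin k ↪ Fin (n + anc)` from a pin numbering and an injective structured wire map. [folklore] -/
def embOf {k : ℕ} {A : Type} (θ' : A ≃ Fin k) (f : A → M.Idx p n) (hf : Function.Injective f) :
    Fin k ↪ Fin (n + M.anc p n) :=
  ⟨fun c => M.θ p n (f (θ'.symm c)), fun c c' h => by
    have := hf ((M.θ p n).injective h)
    exact θ'.symm.injective this⟩

/-- The wire of a pin (definitional). [folklore] -/
theorem embOf_apply {k : ℕ} {A : Type} (θ' : A ≃ Fin k) (f : A → M.Idx p n) (hf : Function.Injective f) (a : A) :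
    M.embOf p n θ' f hf (θ' a) = M.θ p n (f a) := by
  simp [embOf]

/-- Placement of the local step gate. [folklore] -/
def eW : Fin (M.kΛ + M.kΓ + 1 + 1) ↪ Fin (n + M.anc p n) := M.embOf p n M.θLoc (M.locWires p n) (M.locWires_injective p n)
/-- Placement of the erasure gate. [folklore] -/
def eE : Fin (M.kΛ + 1 + 1) ↪ Fin (n + M.anc p n) := M.embOf p n M.θEr (M.erWires p n) (M.erWires_injective p n)
/-- Placement of the controlled swap of cell blocks `j₁ ≠ j₂`. [folklore] -/
def eCS (j₁ j₂ : ℕ) (h₁ : j₁ < nw p n) (h₂ : j₂ < nw p n) (hne : j₁ ≠ j₂) :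
    Fin (1 + M.kΓ + M.kΓ) ↪ Fin (n + M.anc p n) :=
  M.embOf p n M.θCS (M.csWires p n j₁ j₂ h₁ h₂) (M.csWires_injective p n j₁ j₂ h₁ h₂ hne)
/-- Placement of the load gate of input bit `i`. [folklore] -/
def eLD (i : Fin n) : Fin (1 + M.kΓ) ↪ Fin (n + M.anc p n) :=
  M.embOf p n M.θLD (M.ldWires p n i) (M.ldWires_injective p n i)
/-- Placement of the readout gate. [folklore] -/
def eAC : Fin (M.kΛ + 1) ↪ Fin (n + M.anc p n) := M.embOf p n M.θAC (M.acWires p n) (M.acWires_injective p n)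
/-- Placement of the `k`-th final swap. [folklore] -/
def eSW (k : Fin n) : Fin 2 ↪ Fin (n + M.anc p n) :=
  M.embOf p n (Equiv.refl (Fin 2)) (M.swWires p n k) (M.swWires_injective p n k)

/-- Placed gates of the simulating circuit on inputs of length `n`. [folklore] -/
abbrev HGate : Type := QGate M.hcGateSet (n + M.anc p n)

/-- The placed local step gate (Nishimura–Ozawa's `G₁`, once per step). [cite: NishimuraOzawa2002, Thm. 4.3 (proof)] -/
def gW : M.HGate p n := QGate.gate (Sum.inr HCOp.W) (M.eW p n)
/-- The placed erasure gate. [folklore] -/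
def gE : M.HGate p n := QGate.gate (Sum.inr HCOp.E) (M.eE p n)
/-- A placed controlled swap of cell blocks `j₁ ≠ j₂`. [folklore] -/
def gCS (b : Bool) (j₁ j₂ : ℕ) (h₁ : j₁ < nw p n) (h₂ : j₂ < nw p n) (hne : j₁ ≠ j₂) : M.HGate p n :=
  QGate.gate (Sum.inr (HCOp.CS b)) (M.eCS p n j₁ j₂ h₁ h₂ hne)
/-- A placed load gate. [folklore] -/
def gLD (i : Fin n) : M.HGate p n := QGate.gate (Sum.inr HCOp.LOAD) (M.eLD p n i)
/-- The placed readout gate. [folklore] -/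
def gAC : M.HGate p n := QGate.gate (Sum.inr HCOp.ACC) (M.eAC p n)
/-- The `k`-th placed final swap (wires `0` and `k + 1`). [folklore] -/
def gSW (k : Fin n) : M.HGate p n := QGate.gate (Sum.inr HCOp.SWAP) (M.eSW p n k)

/-- The `N - 1` controlled swaps realising the right head move (`rightWord`). [cite: NishimuraOzawa2002, Thm. 4.3 (proof, gate G₂)] -/
def csGatesR : List (M.HGate p n) :=
  (List.finRange (nw p n - 1)).map fun j =>
    M.gCS p n true j.val (j.val + 1) (by have := j.2; omega) (by have := j.2; omega) (by omega)
/-- The `N - 1` controlled swaps of cell `0` with cells `1, 2, …, N-1`, in this order, realising the left head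
move (the inverse cyclic shift is the word `(0 1)(0 2)⋯(0 N-1)` of star transpositions, increasing order — which a
counter program can print). [cite: NishimuraOzawa2002, Thm. 4.3 (proof, gate G₂)] -/
def csGatesL : List (M.HGate p n) :=
  (List.finRange (nw p n - 1)).map fun j =>
    M.gCS p n false 0 (j.val + 1) (Nat.pos_of_ne_zero (NeZero.ne _)) (by have := j.2; omega) (by omega)
/-- **One simulated step**: `W`, the right word, the left word, `E` — `2N` gates, the head-centred analogue of
Nishimura–Ozawa's `K₂ ∘ K₁`. [cite: NishimuraOzawa2002, Thm. 4.3 (proof)] -/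
def stepGates : List (M.HGate p n) := [M.gW p n] ++ M.csGatesR p n ++ M.csGatesL p n ++ [M.gE p n]
/-- Loading the input into the first `n` cells (the encoding `u(x, K)` of §4 realised by gates, since the tree feeds `|x⟩|0…0⟩`). [cite: NishimuraOzawa2002, §4] -/
def loadGates : List (M.HGate p n) := (List.finRange n).map (M.gLD p n)
/-- Readout into the answer wire (wire `n`), then the `n` swaps `(0,1), (0,2), …, (0,n)` which bring the answer to wire
`0`, the wire the tree measures (no case distinction on `n`). [folklore] -/
def finalGates : List (M.HGate p n) := [M.gAC p n] ++ (List.finRange n).map (M.gSW p n)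
/-- **The simulating circuit on inputs of length `n`**: load, `p(n)` steps, readout — `(K₂ ∘ K₁)^t` with pre- and post-processing. [cite: NishimuraOzawa2002, Thm. 4.3] -/
def circGates : List (M.HGate p n) :=
  M.loadGates p n ++ (List.replicate (tm p n) (M.stepGates p n)).flatten ++ M.finalGates p n

/-- The simulating circuit as a `QCircuit` over `𝒢_M` on `n + anc n` wires. [cite: NishimuraOzawa2002, Thm. 4.3] -/
def hcCirc : QCircuit M.hcGateSet (n + M.anc p n) := ⟨M.circGates p n⟩

/-- **The simulating circuit family of `(M, p)`** over `𝒢_M` (`anc n` ancillas on inputs of length `n`);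
its acceptance statistics are EXACTLY those of `M` at time `p(n)` (`acceptProbOn_hcFamily`,
`QuantumTuringMachineCircuitSemantics.lean`). [cite: NishimuraOzawa2002, Thm. 4.3] -/
def hcFamily : QCircuitFamily M.hcGateSet where
  ancillas := M.anc p
  circ n := M.hcCirc p n

/-- A simulated step queries no oracle. [folklore] -/
theorem stepGates_isOracleFree : ∀ g ∈ M.stepGates p n, g.IsOracleFree := by
  intro g hg
  simp only [stepGates, List.mem_append, List.mem_singleton, csGatesR, csGatesL, List.mem_map] at hg
  rcases hg with ((rfl | ⟨j, -, rfl⟩) | ⟨j, -, rfl⟩) | rfl <;> exact trivial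

/-- The simulating circuit queries no oracle. [folklore] -/
theorem circGates_isOracleFree : ∀ g ∈ M.circGates p n, g.IsOracleFree := by
  intro g hg
  simp only [circGates, List.mem_append, List.mem_flatten, List.mem_replicate] at hg
  rcases hg with (hg | ⟨l, ⟨-, rfl⟩, hl⟩) | hg
  · simp only [loadGates, List.mem_map] at hg
    obtain ⟨i, -, rfl⟩ := hg
    exact trivial
  · exact M.stepGates_isOracleFree p n g hl
  · simp only [finalGates, List.mem_append, List.mem_singleton, List.mem_map] at hg
    rcases hg with rfl | ⟨k, -, rfl⟩ <;> exact trivial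

/-- **The simulating family is oracle-free.** [folklore] -/
theorem hcFamily_isOracleFree : (M.hcFamily p).IsOracleFree := fun n =>
  M.circGates_isOracleFree p n

end circuit


/-! ### Wire numbers -/

section wirenumbers

variable (M : QTM) (p : Polynomial ℕ) (n : ℕ)

/-- Input wire `i` is wire `i`. [folklore] -/
theorem θ_ixIn (i : Fin n) : M.θ p n (ixIn i) = Fin.castAdd _ i := by
  simp [θ, ixIn]

/-- Ancilla wires follow the inputs. [folklore] -/
theorem θ_inr (z : M.AncIdx p n) : M.θ p n (Sum.inr z) = Fin.natAdd n (M.θA p n z) := by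
  simp [θ]

/-- The answer wire is wire `n` (so wire `0` on the empty input). [folklore] -/
theorem θ_ixAns_val : (M.θ p n ixAns).val = n := by
  simp [θ, θA, ixAns, finSumFinEquiv_apply_left]
  rfl


/-- Wire number `k ≤ n` is wire `k`. [folklore] -/
theorem θ_wireAt_val (k : ℕ) (hk : k ≤ n) : (M.θ p n (M.wireAt p n k)).val = k := by
  unfold wireAt
  by_cases h : k < n
  · rw [dif_pos h, θ_ixIn]
    simp
  · rw [dif_neg h, θ_ixAns_val]
    omega

end wirenumbers

end QTM

end Literature.Computability.Cryptography

end
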